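import Literature.NumberTheory.Kottwitz1992.ModuliProblem
import Mathlib.RingTheory.SimpleModule.Isotypic
import Mathlib.LinearAlgebra.Matrix.Basis
import Mathlib.LinearAlgebra.Projection
import Mathlib.Algebra.MvPolynomial.Eval
import Mathlib.Algebra.Polynomial.Degree.Defs
import HarnessLib

/-!
# [Kottwitz1992, §5 p. 390] The determinant criterion — DISCHARGED: `Kottwitz1992_5_det_iff_holds`

Kernel-lane companion of the statement carpet ★ `Literature/NumberTheory/Kottwitz1992/ModuliProblem.lean` (precedents ★
`ModuliProblemHolds`, ★ `ModuliProblemMEvenHolds`, ★ `ModuliProblemCasesHolds`): the named fact ★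
`ModuliProblem.Kottwitz1992_5_det_iff` — for a finite-dimensional semisimple algebra `E` over a field `k` with `k`-basis
`α₁, …, α_t`, two finite-dimensional `E`-modules `V`, `W` are isomorphic if and only if
`det_V = det_W ∈ k[X₁, …, X_t]`, `det_V = det(X₁α₁ + ⋯ + X_tα_t ; V ⊗_k k[X₁, …, X_t])` — is PROVED here as
`theorem Kottwitz1992_5_det_iff_holds : Kottwitz1992_5_det_iff`.  THEOREMS ONLY (no definition, no named fact, no `sorry`,
no instance, no notation); cell hodgecm-mathlib, seat B-typ04 (g31); net debt −1.

R. E. Kottwitz, *Points on some Shimura varieties over finite fields*, J. Amer. Math. Soc. 5 (1992), §5 p. 390 L22–L30 (held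
`paper:doi-10-2307-2152772`, p0018).  THE PRINT: «Let `E` be a finite-dimensional semisimple algebra over a field `k`, and let
`α₁, …, α_t` be a `k`-basis for `E`. For any finite-dimensional `E`-module `V` define a polynomial `det_V ∈ k[X₁, …, X_t]` by
`det_V = det(X₁α₁ + ⋯ + X_tα_t ; V ⊗_k k[X₁, …, X_t])`. Then `V` is isomorphic to `W` if and only if `det_V = det_W`. This explains
why we use the determinant rather than the trace, since the analogous assertion regarding the trace is false when the
characteristic of `k` is finite. The proof is easy: replacing `E` by its center and `k` by its algebraic closure, it is enough to
prove the statement for `E = k × ⋯ × k`, in which case it is obvious.»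

THE PROOF GIVEN HERE follows the printed reduction to the centre, but stays over `k` (no extension of scalars is needed):
* (⇒) `det(Σ X_s [ρ(α_s)]_b)` does not depend on the basis `b` of `V` (change of basis = conjugation; reindexing = a permutation
  of rows and columns), so an intertwining `k`-isomorphism `g : V ≃ W` transports the basis and the matrices.
* (⇐) «replacing `E` by its center»: the isotypic components `I` of the left regular module `E` (Mathlib `isotypicComponents`)
  are two-sided ideals, pairwise disjoint, with sum `E`; writing `1 = Σ_I ε_I` (`ε_I ∈ I`) produces central orthogonal idempotents
  with `ε_I x = x` on `I` and `ε_I J = 0` for `J ≠ I`.  «`E = k × ⋯ × k` … obvious»: specialising `X_s ↦ c_s(ε) X + c_s(1 − ε)`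
  (`c(·)` = coordinates in the basis `α`) maps `det_V` to `det(X ρ(ε) + ρ(1 − ε)) = X ^ dim_k (ε V)` (computed in a basis of `V`
  adapted to `V = ε V ⊕ (1 − ε) V`), so `det_V = det_W` forces `dim_k ε_I V = dim_k ε_I W` for every `I`.  Finally `ε_I V` is
  isotypic of the simple type `S_I` of `I` (every simple `E`-module is a minimal left ideal `L`, and `ε_I L = L` forces `L ⊆ I`,
  Mathlib `le_isotypicComponent_iff`), hence `ε_I V ≅ S_I ^ n` with `n · dim_k S_I = dim_k ε_I V`
  (`IsIsotypicOfType.linearEquiv_fun`); so `ε_I V ≅ ε_I W` as `E`-modules for every `I`, and `V = ⊕_I ε_I V ≅ ⊕_I ε_I W = W`.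
HONEST LABEL: HC_CM is proved only modulo the 7 printed citations (2 remaining: hLiu418, h413) until rung 0 closes; this file adds no
citation debt (0 facts, 0 sorry) and discharges 1 named fact of ★ `ModuliProblem`.

## References
* [Kottwitz1992] R. E. Kottwitz, Points on some Shimura varieties over finite fields, J. Amer. Math. Soc. 5 (1992) 373–444, §5 p. 390.
-/

noncomputable section

namespace Literature.NumberTheory.Kottwitz1992.ModuliProblem

open Module

universe u v w

namespace DetIff

/-! ## §1. The generic matrix `Σ_s p_s · [f_s]_b` and its determinant do not depend on the basis `b` -/

section GenMatrix

variable {k : Type*} [Field k] {R : Type*} [CommRing R] [Algebra k R]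
variable {V : Type*} [AddCommGroup V] [Module k V]
variable {σ : Type*} [Fintype σ]

/-- Entries of the generic matrix `Σ_s p_s · [f_s]_b`. [folklore] -/
private theorem genMatrix_apply {ι : Type*} [Fintype ι] [DecidableEq ι] (b : Basis ι k V) (p : σ → R)
    (f : σ → Module.End k V) (i j : ι) :
    (∑ s, p s • (LinearMap.toMatrix b b (f s)).map (algebraMap k R)) i j =
      ∑ s, p s * algebraMap k R (b.repr (f s (b j)) i) := by
  simp [Matrix.sum_apply, LinearMap.toMatrix_apply]

/-- Reindexing the basis permutes rows and columns of the generic matrix. [folklore] -/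
private theorem genMatrix_reindex {ι ι' : Type*} [Fintype ι] [DecidableEq ι] [Fintype ι'] [DecidableEq ι']
    (b : Basis ι k V) (e : ι ≃ ι') (p : σ → R) (f : σ → Module.End k V) :
    (∑ s, p s • (LinearMap.toMatrix (b.reindex e) (b.reindex e) (f s)).map (algebraMap k R)) =
      (∑ s, p s • (LinearMap.toMatrix b b (f s)).map (algebraMap k R)).submatrix e.symm e.symm := by
  ext i j
  simp [genMatrix_apply, Basis.reindex_apply]

/-- Change of basis (same index type) conjugates the generic matrix. [folklore] -/
private theorem genMatrix_basis_change {ι : Type*} [Fintype ι] [DecidableEq ι] (b c : Basis ι k V)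
    (p : σ → R) (f : σ → Module.End k V) :
    (∑ s, p s • (LinearMap.toMatrix b b (f s)).map (algebraMap k R)) =
      (b.toMatrix c).map (algebraMap k R) * (∑ s, p s • (LinearMap.toMatrix c c (f s)).map (algebraMap k R)) *
        (c.toMatrix b).map (algebraMap k R) := by
  rw [Finset.mul_sum, Finset.sum_mul]
  refine Finset.sum_congr rfl fun s _ => ?_
  rw [Matrix.mul_smul, Matrix.smul_mul, ← Matrix.map_mul, ← Matrix.map_mul,
    basis_toMatrix_mul_linearMap_toMatrix_mul_basis_toMatrix]

/-- The determinant of the generic matrix is invariant under change of basis (same index type). [folklore] -/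
private theorem det_genMatrix_basis_change {ι : Type*} [Fintype ι] [DecidableEq ι] (b c : Basis ι k V)
    (p : σ → R) (f : σ → Module.End k V) :
    (∑ s, p s • (LinearMap.toMatrix b b (f s)).map (algebraMap k R)).det =
      (∑ s, p s • (LinearMap.toMatrix c c (f s)).map (algebraMap k R)).det := by
  rw [genMatrix_basis_change b c p f, Matrix.det_mul, Matrix.det_mul]
  have h : ((b.toMatrix c).map (algebraMap k R)).det * ((c.toMatrix b).map (algebraMap k R)).det = 1 := by
    rw [← Matrix.det_mul, ← Matrix.map_mul, Basis.toMatrix_mul_toMatrix_flip,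
      Matrix.map_one (algebraMap k R) (map_zero _) (map_one _), Matrix.det_one]
  calc ((b.toMatrix c).map (algebraMap k R)).det *
        (∑ s, p s • (LinearMap.toMatrix c c (f s)).map (algebraMap k R)).det *
        ((c.toMatrix b).map (algebraMap k R)).det
      = (∑ s, p s • (LinearMap.toMatrix c c (f s)).map (algebraMap k R)).det *
        (((b.toMatrix c).map (algebraMap k R)).det * ((c.toMatrix b).map (algebraMap k R)).det) := by ring
    _ = _ := by rw [h, mul_one]

/-- The determinant of the generic matrix is invariant under change of basis (any index types). [folklore] -/
private theorem det_genMatrix_eq {ι ι' : Type*} [Fintype ι] [DecidableEq ι] [Fintype ι'] [DecidableEq ι']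
    (b : Basis ι k V) (c : Basis ι' k V) (p : σ → R) (f : σ → Module.End k V) :
    (∑ s, p s • (LinearMap.toMatrix b b (f s)).map (algebraMap k R)).det =
      (∑ s, p s • (LinearMap.toMatrix c c (f s)).map (algebraMap k R)).det := by
  rw [← det_genMatrix_basis_change (c.reindex (c.indexEquiv b)) b p f, genMatrix_reindex,
    Matrix.det_submatrix_equiv_self]

/-- Transport along an intertwining isomorphism: the generic matrices of `ρV` in `b` and of `ρW` in `b.map g`
coincide. [folklore] -/
private theorem genMatrix_map {W : Type*} [AddCommGroup W] [Module k W] {ι : Type*} [Fintype ι] [DecidableEq ι]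
    (b : Basis ι k V) (g : V ≃ₗ[k] W) (p : σ → R) (fV : σ → Module.End k V) (fW : σ → Module.End k W)
    (hg : ∀ s v, g (fV s v) = fW s (g v)) :
    (∑ s, p s • (LinearMap.toMatrix (b.map g) (b.map g) (fW s)).map (algebraMap k R)) =
      ∑ s, p s • (LinearMap.toMatrix b b (fV s)).map (algebraMap k R) := by
  refine Finset.sum_congr rfl fun s _ => ?_
  have hc : (g.symm : W →ₗ[k] V) ∘ₗ (fW s ∘ₗ (g : V →ₗ[k] W)) = fV s := by
    ext v
    simp only [LinearMap.coe_comp, Function.comp_apply, LinearEquiv.coe_coe]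
    rw [← hg, LinearEquiv.symm_apply_apply]
  rw [LinearMap.toMatrix_map_left, LinearMap.toMatrix_map_right, hc]

end GenMatrix

/-! ## §2. Specialising `det_V` at an idempotent: `det(X ρ(ε) + ρ(1 − ε)) = X ^ dim (ε V)` -/

section Idempotent

variable {k : Type*} [Field k] {E : Type*} [Ring E] [Algebra k E] {t : ℕ}
variable {V : Type*} [AddCommGroup V] [Module k V]

/-- `det_V` is the determinant of the generic matrix in `Module.finBasis`, and a `k`-algebra evaluation `X ↦ x` maps it to the
determinant of the specialised matrix. [folklore] -/
private theorem aeval_detPoly [FiniteDimensional k V] {R : Type*} [CommRing R] [Algebra k R] (x : Fin t → R)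
    (α : Basis (Fin t) k E) (ρ : E →ₐ[k] Module.End k V) :
    MvPolynomial.aeval x (detPoly α ρ) =
      (∑ s, x s • (LinearMap.toMatrix (Module.finBasis k V) (Module.finBasis k V) (ρ (α s))).map
        (algebraMap k R)).det := by
  rw [detPoly, AlgHom.map_det]
  congr 1
  ext i j
  simp [Matrix.sum_apply, MvPolynomial.aeval_X]

/-- Linearity of the generic matrix in the element of `E`: at the point `x_s = c_s(e) r + c_s(e')` (coordinates in the basis
`α`) the generic matrix of `ρ ∘ α` is `r [ρ e] + [ρ e']`. [folklore] -/
private theorem genMatrix_point {R : Type*} [CommRing R] [Algebra k R] {ι : Type*} [Fintype ι] [DecidableEq ι]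
    (b : Basis ι k V) (α : Basis (Fin t) k E) (ρ : E →ₐ[k] Module.End k V) (e e' : E) (r : R) :
    (∑ s, (algebraMap k R (α.repr e s) * r + algebraMap k R (α.repr e' s)) •
        (LinearMap.toMatrix b b (ρ (α s))).map (algebraMap k R)) =
      r • (LinearMap.toMatrix b b (ρ e)).map (algebraMap k R) +
        (LinearMap.toMatrix b b (ρ e')).map (algebraMap k R) := by
  have key : ∀ x : E, ρ x = ∑ s, α.repr x s • ρ (α s) := fun x => by
    conv_lhs => rw [← α.sum_repr x]
    rw [map_sum]
    exact Finset.sum_congr rfl fun s _ => by rw [map_smul]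
  ext i j
  rw [genMatrix_apply]
  simp only [Matrix.add_apply, Matrix.smul_apply, Matrix.map_apply, LinearMap.toMatrix_apply, smul_eq_mul]
  rw [key e, key e']
  simp only [LinearMap.coe_sum, Finset.sum_apply, LinearMap.smul_apply, map_sum, map_smul,
    Finsupp.coe_finsetSum, Finsupp.coe_smul, Pi.smul_apply, smul_eq_mul, map_mul, Finset.mul_sum,
    ← Finset.sum_add_distrib]
  refine Finset.sum_congr rfl fun s _ => ?_
  ring

/-- A basis of `V` adapted to an idempotent `P`: `P` fixes the first block and kills the second, and the first block has
`dim_k (range P)` elements. [folklore] -/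
private theorem exists_adapted_basis [FiniteDimensional k V] (P : Module.End k V) (hP : IsIdempotentElem P) :
    ∃ b : Basis (Fin (finrank k (LinearMap.range P)) ⊕ Fin (finrank k (LinearMap.ker P))) k V,
      (∀ i, P (b (Sum.inl i)) = b (Sum.inl i)) ∧ (∀ j, P (b (Sum.inr j)) = 0) := by
  have hc : IsCompl (LinearMap.range P) (LinearMap.ker P) := LinearMap.IsIdempotentElem.isCompl hP
  refine ⟨((Module.finBasis k (LinearMap.range P)).prod (Module.finBasis k (LinearMap.ker P))).map
    (Submodule.prodEquivOfIsCompl _ _ hc), fun i => ?_, fun j => ?_⟩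
  · have hmem : ((Module.finBasis k (LinearMap.range P)) i : V) ∈ LinearMap.range P := Submodule.coe_mem _
    have hfix : P ((Module.finBasis k (LinearMap.range P)) i : V) = (Module.finBasis k (LinearMap.range P)) i :=
      (LinearMap.IsIdempotentElem.mem_range_iff hP).mp hmem
    simpa [Submodule.coe_prodEquivOfIsCompl'] using hfix
  · simp [Submodule.coe_prodEquivOfIsCompl']

/-- In an adapted basis, `r [P] + [1 − P]` is the diagonal matrix `diag(r, …, r, 1, …, 1)`. [folklore] -/
private theorem genMatrix_adapted {R : Type*} [CommRing R] [Algebra k R] (P : Module.End k V) {ιa ιc : Type*}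
    [Fintype ιa] [Fintype ιc] [DecidableEq ιa] [DecidableEq ιc] (b : Basis (ιa ⊕ ιc) k V)
    (h₁ : ∀ i, P (b (Sum.inl i)) = b (Sum.inl i)) (h₂ : ∀ j, P (b (Sum.inr j)) = 0) (r : R) :
    r • (LinearMap.toMatrix b b P).map (algebraMap k R) + (LinearMap.toMatrix b b (1 - P)).map (algebraMap k R) =
      Matrix.diagonal (Sum.elim (fun _ => r) (fun _ => 1)) := by
  ext i j
  rcases j with j | j
  · have e1 : b.repr (P (b (Sum.inl j))) = Finsupp.single (Sum.inl j) 1 := by rw [h₁, b.repr_self]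
    have e2 : b.repr ((1 - P) (b (Sum.inl j))) = 0 := by simp [h₁]
    simp only [Matrix.add_apply, Matrix.smul_apply, Matrix.map_apply, LinearMap.toMatrix_apply, e1, e2,
      Finsupp.single_apply, Finsupp.coe_zero, Pi.zero_apply, map_zero, smul_eq_mul, add_zero,
      Matrix.diagonal_apply]
    rcases i with i | i
    · by_cases hij : i = j
      · subst hij; simp
      · have : (Sum.inl j : ιa ⊕ ιc) ≠ Sum.inl i := by simpa using Ne.symm hij
        have : (Sum.inl i : ιa ⊕ ιc) ≠ Sum.inl j := by simpa using hij
        simp [*]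
    · simp
  · have e1 : b.repr (P (b (Sum.inr j))) = 0 := by simp [h₂]
    have e2 : b.repr ((1 - P) (b (Sum.inr j))) = Finsupp.single (Sum.inr j) 1 := by simp [h₂]
    simp only [Matrix.add_apply, Matrix.smul_apply, Matrix.map_apply, LinearMap.toMatrix_apply, e1, e2,
      Finsupp.single_apply, Finsupp.coe_zero, Pi.zero_apply, map_zero, smul_eq_mul, mul_zero, zero_add,
      Matrix.diagonal_apply]
    rcases i with i | i
    · simp
    · by_cases hij : i = j
      · subst hij; simp
      · have : (Sum.inr j : ιa ⊕ ιc) ≠ Sum.inr i := by simpa using Ne.symm hij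
        have : (Sum.inr i : ιa ⊕ ιc) ≠ Sum.inr j := by simpa using hij
        simp [*]

/-- **«for `E = k × ⋯ × k` … it is obvious»**, the computational core: specialising `X_s ↦ c_s(e) X + c_s(1 − e)` for an
idempotent `e ∈ E` maps `det_V` to `X ^ dim_k (e V)`. [cite: Kottwitz1992, §5 (p. 390)] -/
private theorem aeval_detPoly_idempotent [FiniteDimensional k V] (α : Basis (Fin t) k E)
    (ρ : E →ₐ[k] Module.End k V) {e : E} (he : IsIdempotentElem e) :
    MvPolynomial.aeval
        (fun s => algebraMap k (Polynomial k) (α.repr e s) * Polynomial.X + algebraMap k (Polynomial k) (α.repr (1 - e) s))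
        (detPoly α ρ) =
      Polynomial.X ^ finrank k (LinearMap.range (ρ e)) := by
  classical
  have hP : IsIdempotentElem (ρ e) := he.map ρ
  obtain ⟨b, h₁, h₂⟩ := exists_adapted_basis (ρ e) hP
  rw [aeval_detPoly, det_genMatrix_eq (Module.finBasis k V) b, genMatrix_point b α ρ e (1 - e) Polynomial.X, map_sub,
    map_one, genMatrix_adapted (ρ e) b h₁ h₂, Matrix.det_diagonal, Fintype.prod_sum_type]
  simp

end Idempotent

/-! ## §3. «Replacing `E` by its center»: central idempotents from the isotypic components of `E`, and the structure of
`E`-modules they cut out -/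

section Structure

variable {E : Type*} [Ring E]

/-- Distinct isotypic components of `E` meet in `0`. [folklore] -/
private theorem eq_zero_of_mem_comp {I J : isotypicComponents E E} (hIJ : I ≠ J) {x : E}
    (hI : x ∈ (I : Submodule E E)) (hJ : x ∈ (J : Submodule E E)) : x = 0 := by
  have hd : Disjoint (I : Submodule E E) (J : Submodule E E) :=
    (sSupIndep_isotypicComponents E E).pairwiseDisjoint I.2 J.2 (fun h => hIJ (Subtype.ext h))
  have : x ∈ (I : Submodule E E) ⊓ (J : Submodule E E) := ⟨hI, hJ⟩
  rwa [disjoint_iff.mp hd, Submodule.mem_bot] at this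

/-- The isotypic components of the regular module are two-sided ideals. [folklore] -/
private theorem mul_mem_comp (I : isotypicComponents E E) {x : E} (hx : x ∈ (I : Submodule E E)) (y : E) :
    x * y ∈ (I : Submodule E E) := by
  have h2 : Ideal.IsTwoSided (I : Submodule E E) :=
    isFullyInvariant_iff_isTwoSided.mp (.of_mem_isotypicComponents I.2)
  exact h2.mul_mem_of_left y hx

variable [Fintype (isotypicComponents E E)]

/-- `1 = Σ_I ε_I` with `ε_I` in the isotypic component `I` of `E`. [folklore] -/
private theorem exists_partition_of_one [IsSemisimpleRing E] :
    ∃ ε : isotypicComponents E E → E, (∀ I : isotypicComponents E E, ε I ∈ (I : Submodule E E)) ∧ ∑ I, ε I = 1 := by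
  have htop : (⨆ I ∈ (Finset.univ : Finset (isotypicComponents E E)), (I : Submodule E E)) = ⊤ := by
    rw [← sSup_isotypicComponents E E, sSup_eq_iSup']
    simp
  have h1 : (1 : E) ∈ ⨆ I ∈ (Finset.univ : Finset (isotypicComponents E E)), (I : Submodule E E) := by
    rw [htop]; exact Submodule.mem_top
  obtain ⟨μ, hμ⟩ := (Submodule.mem_iSup_finset_iff_exists_sum _ _).mp h1
  exact ⟨fun I => (μ I : E), fun I => Submodule.coe_mem _, hμ⟩

/-- The partition of unity `ε` acts as the identity on its own component … [folklore] -/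
private theorem eps_mul_of_mem {ε : isotypicComponents E E → E}
    (hε : ∀ I : isotypicComponents E E, ε I ∈ (I : Submodule E E)) (hε1 : ∑ I, ε I = 1)
    (I : isotypicComponents E E) {x : E} (hx : x ∈ (I : Submodule E E)) : ε I * x = x := by
  have hx1 : (∑ J, ε J) * x = x := by rw [hε1, one_mul]
  rw [Finset.sum_mul, Finset.sum_eq_single I (fun J _ hJI => ?_) (fun h => (h (Finset.mem_univ _)).elim)] at hx1
  · exact hx1
  · exact eq_zero_of_mem_comp hJI (mul_mem_comp J (hε J) x) (Submodule.smul_mem _ _ hx)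

omit [Fintype (isotypicComponents E E)] in
/-- … and kills the other components. [folklore] -/
private theorem eps_mul_of_mem_other {ε : isotypicComponents E E → E}
    (hε : ∀ I : isotypicComponents E E, ε I ∈ (I : Submodule E E))
    {I J : isotypicComponents E E} (hIJ : I ≠ J) {x : E} (hx : x ∈ (J : Submodule E E)) : ε I * x = 0 :=
  eq_zero_of_mem_comp hIJ (mul_mem_comp I (hε I) x) (Submodule.smul_mem _ _ hx)

/-- The `ε_I` are central. [folklore] -/
private theorem eps_comm {ε : isotypicComponents E E → E}
    (hε : ∀ I : isotypicComponents E E, ε I ∈ (I : Submodule E E)) (hε1 : ∑ I, ε I = 1)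
    (I : isotypicComponents E E) (a : E) : ε I * a = a * ε I := by
  have ha : a = ∑ J, a * ε J := by rw [← Finset.mul_sum, hε1, mul_one]
  conv_lhs => rw [ha, Finset.mul_sum]
  rw [Finset.sum_eq_single I (fun J _ hJI => ?_) (fun h => (h (Finset.mem_univ _)).elim)]
  · exact eps_mul_of_mem hε hε1 I (Submodule.smul_mem _ a (hε I))
  · exact eps_mul_of_mem_other hε (Ne.symm hJI) (Submodule.smul_mem _ a (hε J))

/-- The `ε_I` are orthogonal idempotents: `ε_I ε_J = δ_{IJ} ε_I`. [folklore] -/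
private theorem eps_mul_eps {ε : isotypicComponents E E → E}
    (hε : ∀ I : isotypicComponents E E, ε I ∈ (I : Submodule E E)) (hε1 : ∑ I, ε I = 1)
    (I J : isotypicComponents E E) : ε I * ε J = if I = J then ε I else 0 := by
  split_ifs with h
  · subst h; exact eps_mul_of_mem hε hε1 I (hε I)
  · exact eps_mul_of_mem_other hε h (hε J)

variable {M : Type*} [AddCommGroup M] [Module E M]

/-- The central idempotents `ε_I` act `E`-linearly. [folklore] -/
private theorem exists_smul_linearMap {ε : isotypicComponents E E → E}
    (hε : ∀ I : isotypicComponents E E, ε I ∈ (I : Submodule E E)) (hε1 : ∑ I, ε I = 1) :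
    ∃ φ : isotypicComponents E E → (M →ₗ[E] M), ∀ I m, φ I m = ε I • m :=
  ⟨fun I =>
    { toFun := fun x => ε I • x
      map_add' := fun x y => smul_add _ _ _
      map_smul' := fun a x => by simp only [smul_smul, RingHom.id_apply, eps_comm hε hε1 I a] },
    fun _ _ => rfl⟩

/-- On any `E`-module, an element of the range of the idempotent `ε_I` is fixed by `ε_I`. [folklore] -/
private theorem eps_smul_of_mem_range {ε : isotypicComponents E E → E}
    (hε : ∀ I : isotypicComponents E E, ε I ∈ (I : Submodule E E)) (hε1 : ∑ I, ε I = 1)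
    (I : isotypicComponents E E) (φ : M →ₗ[E] M) (hφ : ∀ m, φ m = ε I • m) {m : M}
    (hm : m ∈ LinearMap.range φ) : ε I • m = m := by
  obtain ⟨m', rfl⟩ := hm
  rw [hφ, smul_smul, eps_mul_of_mem hε hε1 I (hε I)]

/-- **«Replacing `E` by its center»**: the `E`-submodule `ε_I M` cut out by the central idempotent of the isotypic component
`I = E_S` of `E` is isotypic of type `S` — every simple `E`-module is a minimal left ideal `L`, and `ε_I L = L` puts `L` inside
`I`. [cite: Kottwitz1992, §5 (p. 390)] -/
private theorem isIsotypicOfType_range [IsSemisimpleRing E] {ε : isotypicComponents E E → E}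
    (hε : ∀ I : isotypicComponents E E, ε I ∈ (I : Submodule E E)) (hε1 : ∑ I, ε I = 1)
    (I : isotypicComponents E E) (S : Submodule E E) [IsSimpleModule E S]
    (hS : (I : Submodule E E) = isotypicComponent E E S) (φ : M →ₗ[E] M) (hφ : ∀ m, φ m = ε I • m) :
    IsIsotypicOfType E (LinearMap.range φ) S := by
  intro m hm
  obtain ⟨L, ⟨eL⟩⟩ := IsSemisimpleRing.exists_linearEquiv_ideal_of_isSimpleModule E m
  haveI hL : IsSimpleModule E L := IsSimpleModule.congr eL.symm
  -- `ε_I` fixes `L` pointwise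
  have hfix : ∀ y : L, ε I * (y : E) = y := fun y => by
    have h1 : ε I • (((eL.symm y : m) : LinearMap.range φ) : M) = (((eL.symm y : m) : LinearMap.range φ) : M) :=
      eps_smul_of_mem_range hε hε1 I φ hφ (Submodule.coe_mem _)
    have h2 : ε I • eL.symm y = eL.symm y := by
      apply Subtype.ext; apply Subtype.ext; exact h1
    have h3 : ε I • y = y := by simpa using congrArg eL h2
    exact congrArg Subtype.val h3
  -- hence `L ≤ I`
  have hLI : (L : Submodule E E) ≤ (I : Submodule E E) := fun x hx => by
    have h := hfix ⟨x, hx⟩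
    dsimp only at h
    rw [← h]
    exact mul_mem_comp I (hε I) x
  rw [hS] at hLI
  have hiso : IsIsotypicOfType E L S := le_isotypicComponent_iff.mp hLI
  haveI : IsSimpleModule E (⊤ : Submodule E L) := IsSimpleModule.congr Submodule.topEquiv
  obtain ⟨eS⟩ := hiso ⊤
  exact ⟨eL.trans (Submodule.topEquiv.symm.trans eS)⟩

/-- `M ≅ Π_I ε_I M`. [folklore] -/
private theorem nonempty_linearEquiv_pi {ε : isotypicComponents E E → E}
    (hε : ∀ I : isotypicComponents E E, ε I ∈ (I : Submodule E E)) (hε1 : ∑ I, ε I = 1)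
    (χ : isotypicComponents E E → (M →ₗ[E] M)) (hχ : ∀ I x, χ I x = ε I • x) :
    Nonempty (M ≃ₗ[E] (Π I, LinearMap.range (χ I))) := by
  classical
  refine ⟨{ toFun := fun x I => ⟨χ I x, LinearMap.mem_range_self _ _⟩
            map_add' := fun x y => by ext I; simp
            map_smul' := fun a x => by ext I; simp
            invFun := fun w => ∑ I, (w I : M)
            left_inv := fun x => ?_
            right_inv := fun w => ?_ }⟩
  · simp only [hχ]
    rw [← Finset.sum_smul, hε1, one_smul]
  · ext I
    simp only [hχ, Finset.smul_sum]
    rw [Finset.sum_eq_single I (fun J _ hJI => ?_) (fun hI => (hI (Finset.mem_univ _)).elim)]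
    · exact eps_smul_of_mem_range hε hε1 I (χ I) (hχ I) (Submodule.coe_mem _)
    · obtain ⟨y, hy⟩ := (w J).2
      rw [← hy, hχ, smul_smul, eps_mul_eps hε hε1, if_neg (Ne.symm hJI), zero_smul]

end Structure

/-! ## §4. Equality of the dimensions of the pieces `ε_I V` forces `V ≅ W` -/

section Modules

variable {k : Type*} [Field k] {E : Type*} [Ring E] [Algebra k E]
variable {M : Type*} [AddCommGroup M] [Module k M] [Module E M] [IsScalarTower k E M] [FiniteDimensional k M]
variable {N : Type*} [AddCommGroup N] [Module k N] [Module E N] [IsScalarTower k E N] [FiniteDimensional k N]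

/-- A `k`-finite-dimensional `E`-submodule is `k`-finite and `E`-finite. [folklore] -/
private theorem finite_submodule (p : Submodule E M) : Module.Finite k p ∧ Module.Finite E p := by
  have hk : Module.Finite k p :=
    Module.Finite.of_injective (p.subtype.restrictScalars k) Subtype.val_injective
  exact ⟨hk, Module.Finite.of_restrictScalars_finite k E p⟩

/-- `dim_k (S ^ n) = n · dim_k S` for a left ideal `S` of `E`. [folklore] -/
private theorem finrank_fun_ideal [FiniteDimensional k E] (S : Submodule E E) (n : ℕ) :
    finrank k (Fin n → S) = n * finrank k S := by
  haveI : Module.Finite k S := Module.Finite.of_injective (S.subtype.restrictScalars k) Subtype.val_injective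
  rw [Module.finrank_pi_fintype k, Finset.sum_const, Finset.card_univ, Fintype.card_fin, smul_eq_mul]

omit [FiniteDimensional k M] in
/-- The `k`-dimension of an `E`-submodule is that of the underlying `k`-submodule. [folklore] -/
private theorem finrank_restrictScalars (p : Submodule E M) : finrank k (p.restrictScalars k) = finrank k p :=
  LinearEquiv.finrank_eq
    ({ (AddEquiv.refl p) with map_smul' := fun _ _ => rfl } : (p.restrictScalars k) ≃ₗ[k] p)

variable [FiniteDimensional k E] [IsSemisimpleRing E] [Fintype (isotypicComponents E E)]

/-- Two pieces `ε_I M`, `ε_I N` of the same `k`-dimension are isomorphic `E`-modules (both are `S_I ^ n`,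
`n · dim_k S_I = dim_k ε_I M`). [cite: Kottwitz1992, §5 (p. 390)] -/
private theorem nonempty_linearEquiv_range {ε : isotypicComponents E E → E}
    (hε : ∀ I : isotypicComponents E E, ε I ∈ (I : Submodule E E)) (hε1 : ∑ I, ε I = 1)
    (I : isotypicComponents E E) (φ : M →ₗ[E] M) (hφ : ∀ m, φ m = ε I • m)
    (ψ : N →ₗ[E] N) (hψ : ∀ n, ψ n = ε I • n)
    (h : finrank k (LinearMap.range φ) = finrank k (LinearMap.range ψ)) :
    Nonempty (LinearMap.range φ ≃ₗ[E] LinearMap.range ψ) := by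
  obtain ⟨S, hS, hI⟩ := I.2
  haveI : Module.Finite E (LinearMap.range φ) := (finite_submodule (k := k) _).2
  haveI : Module.Finite E (LinearMap.range ψ) := (finite_submodule (k := k) _).2
  haveI : Module.Finite k (LinearMap.range φ) := (finite_submodule (k := k) _).1
  haveI : Module.Finite k (LinearMap.range ψ) := (finite_submodule (k := k) _).1
  obtain ⟨n, ⟨eM⟩⟩ := (isIsotypicOfType_range hε hε1 I S hI φ hφ).linearEquiv_fun
  obtain ⟨n', ⟨eN⟩⟩ := (isIsotypicOfType_range hε hε1 I S hI ψ hψ).linearEquiv_fun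
  have hM : finrank k (LinearMap.range φ) = n * finrank k S := by
    rw [(eM.restrictScalars k).finrank_eq, finrank_fun_ideal]
  have hN : finrank k (LinearMap.range ψ) = n' * finrank k S := by
    rw [(eN.restrictScalars k).finrank_eq, finrank_fun_ideal]
  haveI : Nontrivial S := IsSimpleModule.nontrivial E S
  haveI : Module.Finite k S := Module.Finite.of_injective (S.subtype.restrictScalars k) Subtype.val_injective
  have hpos : 0 < finrank k S := Module.finrank_pos
  have hnn : n = n' := Nat.eq_of_mul_eq_mul_right hpos (by rw [← hM, ← hN, h])
  subst hnn
  exact ⟨eM.trans eN.symm⟩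

omit [FiniteDimensional k M] [FiniteDimensional k E] [IsSemisimpleRing E] [Fintype (isotypicComponents E E)] in
/-- The piece `ε_I M`, as a `k`-subspace, is the range of `ε_I` acting `k`-linearly. [folklore] -/
private theorem finrank_range_eq (e : E) (φ : M →ₗ[E] M) (hφ : ∀ m, φ m = e • m) :
    finrank k (LinearMap.range φ) = finrank k (LinearMap.range (DistribSMul.toLinearMap k M e)) := by
  have key : (LinearMap.range φ).restrictScalars k = LinearMap.range (DistribSMul.toLinearMap k M e) := by
    ext x
    simp [hφ, LinearMap.mem_range]
  rw [← finrank_restrictScalars, key]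

/-- **The structure theorem behind the criterion**: if every idempotent of `E` cuts out pieces of `V` and `W` of the same
`k`-dimension, then `V ≅ W` as `E`-modules. [cite: Kottwitz1992, §5 (p. 390)] -/
private theorem nonempty_linearEquiv_of_finrank_eq
    (h : ∀ e : E, IsIdempotentElem e →
      finrank k (LinearMap.range (DistribSMul.toLinearMap k M e)) =
        finrank k (LinearMap.range (DistribSMul.toLinearMap k N e))) :
    Nonempty (M ≃ₗ[E] N) := by
  classical
  obtain ⟨ε, hε, hε1⟩ := exists_partition_of_one (E := E)
  obtain ⟨φ, hφ⟩ := exists_smul_linearMap (M := M) hε hε1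
  obtain ⟨ψ, hψ⟩ := exists_smul_linearMap (M := N) hε hε1
  obtain ⟨eM⟩ := nonempty_linearEquiv_pi hε hε1 φ hφ
  obtain ⟨eN⟩ := nonempty_linearEquiv_pi hε hε1 ψ hψ
  have hpiece : ∀ I, Nonempty (LinearMap.range (φ I) ≃ₗ[E] LinearMap.range (ψ I)) := fun I => by
    refine nonempty_linearEquiv_range (k := k) hε hε1 I (φ I) (hφ I) (ψ I) (hψ I) ?_
    have hidem : IsIdempotentElem (ε I) := by
      have := eps_mul_eps hε hε1 I I
      rw [if_pos rfl] at this
      exact this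
    rw [finrank_range_eq (ε I) (φ I) (hφ I), finrank_range_eq (ε I) (ψ I) (hψ I)]
    exact h (ε I) hidem
  exact ⟨eM.trans ((LinearEquiv.piCongrRight fun I => (hpiece I).some).trans eN.symm)⟩

end Modules

end DetIff

/-! ## §5. The determinant criterion -/

open DetIff in
/-- **[Kottwitz1992, §5 p. 390] The determinant criterion**, DISCHARGED: for a finite-dimensional semisimple algebra `E` over a
field `k` with `k`-basis `α₁, …, α_t`, two finite-dimensional `E`-modules `V`, `W` are isomorphic if and only if
`det_V = det_W`. [cite: Kottwitz1992, §5 (p. 390)] -/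
theorem Kottwitz1992_5_det_iff_holds : Kottwitz1992_5_det_iff.{u, v, w} := by
  intro k _ E _ _ _ _ t α V W _ _ _ _ _ _ ρV ρW
  classical
  constructor
  · -- (⇒) transport the basis along `g`
    rintro ⟨g, hg⟩
    rw [detPoly, detPoly]
    have hC : (MvPolynomial.C : k → MvPolynomial (Fin t) k) = algebraMap k (MvPolynomial (Fin t) k) := by
      rw [MvPolynomial.algebraMap_eq]
    simp only [hC]
    rw [DetIff.det_genMatrix_eq (Module.finBasis k W) ((Module.finBasis k V).map g),
      DetIff.genMatrix_map (Module.finBasis k V) g _ (fun s => ρV (α s)) (fun s => ρW (α s)) (fun s v => hg _ v)]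
  · -- (⇐) dimensions of the pieces, then the structure theorem
    intro hdet
    letI : Module E V := Module.compHom V (ρV : E →+* Module.End k V)
    letI : Module E W := Module.compHom W (ρW : E →+* Module.End k W)
    haveI : IsScalarTower k E V := ⟨fun c a v => by
      change ρV (c • a) v = c • ρV a v
      rw [map_smul]; rfl⟩
    haveI : IsScalarTower k E W := ⟨fun c a v => by
      change ρW (c • a) v = c • ρW a v
      rw [map_smul]; rfl⟩
    haveI : Fintype (isotypicComponents E E) := Fintype.ofFinite _
    have hdim : ∀ e : E, IsIdempotentElem e →
        finrank k (LinearMap.range (DistribSMul.toLinearMap k V e)) =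
          finrank k (LinearMap.range (DistribSMul.toLinearMap k W e)) := by
      intro e he
      have hV := DetIff.aeval_detPoly_idempotent α ρV he
      have hW := DetIff.aeval_detPoly_idempotent α ρW he
      rw [hdet, hW] at hV
      have hn := congrArg Polynomial.natDegree hV
      simp only [Polynomial.natDegree_X_pow] at hn
      have eV : DistribSMul.toLinearMap k V e = ρV e := by ext v; rfl
      have eW : DistribSMul.toLinearMap k W e = ρW e := by ext v; rfl
      rw [eV, eW]
      exact hn.symm
    obtain ⟨g⟩ := DetIff.nonempty_linearEquiv_of_finrank_eq (k := k) (E := E) (M := V) (N := W) hdim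
    refine ⟨g.restrictScalars k, fun a v => ?_⟩
    change g (a • v) = a • g v
    exact map_smul g a v

end Literature.NumberTheory.Kottwitz1992.ModuliProblem
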